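import Summits.BirchSwinnertonDyer.Rank1Residual.ManinAdditive.PsiBrandtDegreeLawAtEight
import Summits.BirchSwinnertonDyer.BirchSwinnertonDyer.Theorems.ManinLocalTwoThreeTamagawaTwoAtEightHolds
import HarnessLib

/-!
# E-desc-133 `DiscriminantValuationAtEight` holds (companion of `PsiBrandtDegreeLawAtEight.lean`; cell bsd-f2-manin, desc g19)

`8 ∥ N ⟹ v₂(Δ_min) ∈ {4, 8, 10, 11}` is the tree theorem `ManinLocalTwoThree.padicValRat_two_Δ_of_padicValNat_conductorNorm_eq_three`
(p712586); hence the Brandt exponent `e(E)` of the ψ-Brandt degree law reads the Kodaira type at 2 faithfully.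

TYPER NOTE (typer g19, T-desc-36b).  SOURCE = HOME/desc/g19/Sketch-desc-g19-holds.lean sha16 f1bf52a30c34e2b2 VERBATIM except this note.  Holds sibling of
`PsiBrandtDegreeLawAtEight.lean`; imports the prover-landed `Theorems.ManinLocalTwoThreeTamagawaTwoAtEightHolds` (p712586; its Summits import cone has
no `Theses` module — checked).  Theorem-only; E-desc-133 `DiscriminantValuationAtEight` DISCHARGED BY NAME (`discriminantValuationAtEight_holds`).
-/

open WeierstrassCurve
open Summit.BirchSwinnertonDyer.BirchSwinnertonDyer.Theorems

namespace Summit.BirchSwinnertonDyer.Rank1Residual.ManinAdditive.PsiBrandt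

/-- E-desc-133 holds: the tree theorem of p712586 (Tate's algorithm at conductor exponent 3). -/
theorem discriminantValuationAtEight_holds : DiscriminantValuationAtEight :=
  fun W _ _ h3 => ManinLocalTwoThree.padicValRat_two_Δ_of_padicValNat_conductorNorm_eq_three W h3

/-- under `8 ∥ N` the Brandt exponent reads the Kodaira type faithfully: `e = 3 ↔ v₂(Δ) = 11` (II*). -/
theorem brandtExponentAtEight_eq_three_iff (W : WeierstrassCurve ℚ) [W.IsElliptic] [W.IsGloballyMinimal]
    (h3 : padicValNat 2 (W.conductorNorm ℤ) = 3) : brandtExponentAtEight W = 3 ↔ padicValRat 2 W.Δ = 11 := by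
  unfold brandtExponentAtEight
  rcases discriminantValuationAtEight_holds W h3 with h | h | h | h <;> simp [h]

end Summit.BirchSwinnertonDyer.Rank1Residual.ManinAdditive.PsiBrandt
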